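import Summits.Ventures.Crystal3D.Theorems.StickyWulffConstantCoaxialWallLawTerracePropagation
import Summits.Ventures.Crystal3D.Theorems.StickyWulffConstantGenericWallFloorStepGain
import HarnessLib

/-!
# In-plane steering on a coherent twin plate (the hexagon lemma)

HONEST FRAMING. Venture `Summits/Ventures/Crystal3D` (cell `crystal3d-full`), helper for the crux
`GenericWallFloor` (stmt-Ventures-19480) of `route-Ventures-StickyWulffConstant`, REGISTERED line `WallLedgerG`,
open stub `stub_twoSlabAdhesion` (general fillings; the `Σ3ⁿ` chain pairs, refusal walks).  Rung credit only;
F-C1 not moved.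

`exists_inPlane_slot_ge`: for a frame `F` and a unit menu normal `n`, the six IN-PLANE slots `F(uᵢ − uⱼ)`
form a regular hexagon of the plane `⊥ n`; hence for every unit vector `g ⊥ n` some in-plane slot has
`⟪F w, g⟫ ≥ √3/2`.  `exists_inPlane_steering_slot`: for unit `z, u ⊥ n` with `z ⊥ u` some in-plane slot has
`⟪F w, z⟫ ≥ 1/5` and `⟪F w, u⟫ ≥ 1/5` (apply the first to `g = (z + u)/√2`).  This is the steering used to
SLIDE up a terminal twin plate inside a tilted tube without ever crossing it.
WHAT THIS IS NOT: no packing statement; F-C1 not moved.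
-/

noncomputable section

namespace Summit.Ventures.Crystal3D.Theorems

open Summit.Ventures.Crystal3D Finset
open Literature.MathematicalPhysics.StatisticalMechanics (fccStacking)
open scoped InnerProductSpace

/-- **The hexagon lemma.**  See the module docstring. -/
theorem exists_inPlane_slot_ge (F : EuclideanSpace ℝ (Fin 3) ≃ₗᵢ[ℝ] EuclideanSpace ℝ (Fin 3))
    {n g : EuclideanSpace ℝ (Fin 3)} (hn : ‖n‖ = 1)
    (hmenu : ∀ w ∈ fccSlots, ⟪F w, n⟫_ℝ = 0 ∨ ⟪F w, n⟫_ℝ = Real.sqrt (2 / 3) ∨ ⟪F w, n⟫_ℝ = -Real.sqrt (2 / 3))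
    (hg : ‖g‖ = 1) (hgn : ⟪g, n⟫_ℝ = 0) :
    ∃ w ∈ fccSlots, ⟪F w, n⟫_ℝ = 0 ∧ Real.sqrt 3 / 2 ≤ ⟪F w, g⟫_ℝ := by
  have hrpos : 0 < Real.sqrt (2 / 3) := Real.sqrt_pos.2 (by norm_num)
  have h6pos : 0 < Real.sqrt 6 := Real.sqrt_pos.2 (by norm_num)
  obtain ⟨u₁, hu₁, u₂, hu₂, u₃, hu₃, hn₁, hn₂, hn₃, i12, i13, i23, hind, -⟩ := exists_far_frame F hn hmenu
  have n1 := norm_eq_one_of_mem_fccSlots hu₁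
  have n2 := norm_eq_one_of_mem_fccSlots hu₂
  have n3 := norm_eq_one_of_mem_fccSlots hu₃
  have s11 : ⟪u₁, u₁⟫_ℝ = 1 := by rw [real_inner_self_eq_norm_sq, n1, one_pow]
  have s22 : ⟪u₂, u₂⟫_ℝ = 1 := by rw [real_inner_self_eq_norm_sq, n2, one_pow]
  have s33 : ⟪u₃, u₃⟫_ℝ = 1 := by rw [real_inner_self_eq_norm_sq, n3, one_pow]
  have i21 : ⟪u₂, u₁⟫_ℝ = 1 / 2 := by rw [real_inner_comm]; exact i12
  have i31 : ⟪u₃, u₁⟫_ℝ = 1 / 2 := by rw [real_inner_comm]; exact i13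
  have i32 : ⟪u₃, u₂⟫_ℝ = 1 / 2 := by rw [real_inner_comm]; exact i23
  -- in-plane slots
  have hd12 : u₁ - u₂ ∈ fccSlots := sub_mem_fccSlots_of_inner_eq_half hu₁ hu₂ i12
  have hd21 : u₂ - u₁ ∈ fccSlots := sub_mem_fccSlots_of_inner_eq_half hu₂ hu₁ i21
  have hd23 : u₂ - u₃ ∈ fccSlots := sub_mem_fccSlots_of_inner_eq_half hu₂ hu₃ i23
  have hd32 : u₃ - u₂ ∈ fccSlots := sub_mem_fccSlots_of_inner_eq_half hu₃ hu₂ i32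
  have hd31 : u₃ - u₁ ∈ fccSlots := sub_mem_fccSlots_of_inner_eq_half hu₃ hu₁ i31
  have hd13 : u₁ - u₃ ∈ fccSlots := sub_mem_fccSlots_of_inner_eq_half hu₁ hu₃ i13
  have inplane : ∀ {a b : EuclideanSpace ℝ (Fin 3)}, ⟪F a, n⟫_ℝ = Real.sqrt (2 / 3) → ⟪F b, n⟫_ℝ = Real.sqrt (2 / 3) →
      ⟪F (a - b), n⟫_ℝ = 0 := by
    intro a b ha hb; rw [map_sub, inner_sub_left, ha, hb, sub_self]
  -- coordinates of `g`
  set p : ℝ := ⟪F (u₁ - u₂), g⟫_ℝ with hp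
  set q : ℝ := ⟪F (u₂ - u₃), g⟫_ℝ with hq
  have hr : ⟪F (u₃ - u₁), g⟫_ℝ = -(p + q) := by
    rw [hp, hq, map_sub, map_sub, map_sub, inner_sub_left, inner_sub_left, inner_sub_left]; ring
  -- `g = α F(u₁ − u₂) + β F(u₂ − u₃)`
  set α : ℝ := (4 * p + 2 * q) / 3 with hα
  set β : ℝ := (4 * q + 2 * p) / 3 with hβ
  set g' : EuclideanSpace ℝ (Fin 3) := α • F (u₁ - u₂) + β • F (u₂ - u₃) with hg'
  have e11 : ⟪F (u₁ - u₂), F (u₁ - u₂)⟫_ℝ = 1 := by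
    rw [LinearIsometryEquiv.inner_map_map, inner_sub_left, inner_sub_right, inner_sub_right, s11, i12, i21, s22]; norm_num
  have e22 : ⟪F (u₂ - u₃), F (u₂ - u₃)⟫_ℝ = 1 := by
    rw [LinearIsometryEquiv.inner_map_map, inner_sub_left, inner_sub_right, inner_sub_right, s22, i23, i32, s33]; norm_num
  have e12 : ⟪F (u₁ - u₂), F (u₂ - u₃)⟫_ℝ = -(1 / 2) := by
    rw [LinearIsometryEquiv.inner_map_map, inner_sub_left, inner_sub_right, inner_sub_right, i12, i13, s22, i23]; norm_num
  have e21 : ⟪F (u₂ - u₃), F (u₁ - u₂)⟫_ℝ = -(1 / 2) := by rw [real_inner_comm]; exact e12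
  have hx : g - g' = 0 := by
    -- orthogonal to `F u₁, F u₂, F u₃`
    have o1 : ⟪g - g', F (u₁ - u₂)⟫_ℝ = 0 := by
      rw [inner_sub_left, real_inner_comm, ← hp, hg', inner_add_left, real_inner_smul_left, real_inner_smul_left,
        e11, e21, hα, hβ]; ring
    have o2 : ⟪g - g', F (u₂ - u₃)⟫_ℝ = 0 := by
      rw [inner_sub_left, real_inner_comm, ← hq, hg', inner_add_left, real_inner_smul_left, real_inner_smul_left,
        e12, e22, hα, hβ]; ring
    have osum : ⟪g - g', F u₁ + F u₂ + F u₃⟫_ℝ = 0 := by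
      have hsum := sum_eq_sqrt_six_smul (F u₁) (F u₂) (F u₃) n
        (by rw [LinearIsometryEquiv.norm_map, n1]) (by rw [LinearIsometryEquiv.norm_map, n2])
        (by rw [LinearIsometryEquiv.norm_map, n3]) hn
        (by rw [LinearIsometryEquiv.inner_map_map, i12]) (by rw [LinearIsometryEquiv.inner_map_map, i13])
        (by rw [LinearIsometryEquiv.inner_map_map, i23]) hn₁ hn₂ hn₃
      rw [hsum, real_inner_smul_right, inner_sub_left, hgn, hg', inner_add_left, real_inner_smul_left,
        real_inner_smul_left, inplane hn₁ hn₂, inplane hn₂ hn₃]; ring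
    rw [map_sub, inner_sub_right] at o1 o2
    rw [inner_add_right, inner_add_right] at osum
    have a1 : ⟪g - g', F u₁⟫_ℝ = 0 := by linarith
    have a2 : ⟪g - g', F u₂⟫_ℝ = 0 := by linarith
    have a3 : ⟪g - g', F u₃⟫_ℝ = 0 := by linarith
    refine eq_zero_of_inner_eq_zero_of_indep (linearIndependent_map_triple F hind) ?_ ?_ ?_
    · rw [real_inner_comm]; exact a1
    · rw [real_inner_comm]; exact a2
    · rw [real_inner_comm]; exact a3
  have hgg' : g = g' := sub_eq_zero.1 hx
  -- the norm identity `p² + q² + p q = 3/4`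
  have hid : p ^ 2 + q ^ 2 + p * q = 3 / 4 := by
    have h1 : ⟪g, g⟫_ℝ = 1 := by rw [real_inner_self_eq_norm_sq, hg, one_pow]
    rw [hgg'] at h1
    simp only [hg', inner_add_left, inner_add_right, real_inner_smul_left, real_inner_smul_right,
      e11, e12, e21, e22] at h1
    rw [hα, hβ] at h1
    linear_combination (3 / 4 : ℝ) * h1
  have h34 : (Real.sqrt 3 / 2) ^ 2 = 3 / 4 := by rw [div_pow, Real.sq_sqrt (by norm_num)]; norm_num
  have hs3 : 0 ≤ Real.sqrt 3 / 2 := by positivity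
  have big : ∀ v : ℝ, 3 / 4 ≤ v ^ 2 → Real.sqrt 3 / 2 ≤ v ∨ Real.sqrt 3 / 2 ≤ -v := by
    intro v hv
    have hav : Real.sqrt 3 / 2 ≤ |v| := by
      by_contra hlt
      push Not at hlt
      have h1 : |v| ^ 2 < (Real.sqrt 3 / 2) ^ 2 := pow_lt_pow_left₀ hlt (abs_nonneg v) two_ne_zero
      rw [sq_abs, h34] at h1
      linarith
    rcases le_or_gt 0 v with h0 | h0
    · left; rwa [abs_of_nonneg h0] at hav
    · right; rwa [abs_of_neg h0] at hav
  have neg_val : ∀ a b : EuclideanSpace ℝ (Fin 3), ⟪F (b - a), g⟫_ℝ = -⟪F (a - b), g⟫_ℝ := by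
    intro a b; rw [show b - a = -(a - b) by abel, map_neg, inner_neg_left]
  by_cases hpq : 0 ≤ p * q
  · have h2 : 3 / 4 ≤ (p + q) ^ 2 := by
      have e : (p + q) ^ 2 = p ^ 2 + q ^ 2 + p * q + p * q := by ring
      rw [e]; linarith
    rcases big (p + q) h2 with h | h
    · refine ⟨u₁ - u₃, hd13, inplane hn₁ hn₃, ?_⟩
      rw [neg_val u₃ u₁, hr, neg_neg]; exact h
    · refine ⟨u₃ - u₁, hd31, inplane hn₃ hn₁, ?_⟩
      rw [hr]; exact h
  · push Not at hpq
    have hcase : 3 / 4 ≤ p ^ 2 ∨ 3 / 4 ≤ q ^ 2 := by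
      by_cases h1 : q ^ 2 + p * q ≤ 0
      · left; linarith
      · right
        push Not at h1
        have hprod : (q ^ 2 + p * q) * (p ^ 2 + p * q) ≤ 0 := by
          have e : (q ^ 2 + p * q) * (p ^ 2 + p * q) = (p * q) * (p + q) ^ 2 := by ring
          rw [e]; exact mul_nonpos_of_nonpos_of_nonneg hpq.le (sq_nonneg _)
        have h2 : p ^ 2 + p * q ≤ 0 := by
          by_contra h3; push Not at h3
          have := mul_pos h1 h3; linarith
        linarith
    rcases hcase with h | h
    · rcases big p h with h' | h'
      · exact ⟨u₁ - u₂, hd12, inplane hn₁ hn₂, h'⟩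
      · exact ⟨u₂ - u₁, hd21, inplane hn₂ hn₁, by rw [neg_val u₁ u₂]; exact h'⟩
    · rcases big q h with h' | h'
      · exact ⟨u₂ - u₃, hd23, inplane hn₂ hn₃, h'⟩
      · exact ⟨u₃ - u₂, hd32, inplane hn₃ hn₂, by rw [neg_val u₂ u₃]; exact h'⟩

/-- **In-plane steering.**  For unit `z, u ⊥ n` with `z ⊥ u` there is an in-plane slot with
`⟪F w, z⟫ ≥ 1/5` and `⟪F w, u⟫ ≥ 1/5`. -/
theorem exists_inPlane_steering_slot (F : EuclideanSpace ℝ (Fin 3) ≃ₗᵢ[ℝ] EuclideanSpace ℝ (Fin 3))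
    {n z u : EuclideanSpace ℝ (Fin 3)} (hn : ‖n‖ = 1)
    (hmenu : ∀ w ∈ fccSlots, ⟪F w, n⟫_ℝ = 0 ∨ ⟪F w, n⟫_ℝ = Real.sqrt (2 / 3) ∨ ⟪F w, n⟫_ℝ = -Real.sqrt (2 / 3))
    (hz : ‖z‖ = 1) (hu : ‖u‖ = 1) (hzn : ⟪z, n⟫_ℝ = 0) (hun : ⟪u, n⟫_ℝ = 0) (hzu : ⟪z, u⟫_ℝ = 0) :
    ∃ w ∈ fccSlots, ⟪F w, n⟫_ℝ = 0 ∧ (1 / 5 : ℝ) ≤ ⟪F w, z⟫_ℝ ∧ (1 / 5 : ℝ) ≤ ⟪F w, u⟫_ℝ := by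
  have h22 : Real.sqrt 2 * Real.sqrt 2 = 2 := Real.mul_self_sqrt (by norm_num)
  set g : EuclideanSpace ℝ (Fin 3) := (Real.sqrt 2 / 2) • (z + u) with hg
  have hg1 : ‖g‖ = 1 := by
    have hzq2 : ‖z + u‖ ^ 2 = 2 := by rw [norm_add_sq_real, hz, hu, hzu]; norm_num
    have : ‖g‖ ^ 2 = 1 := by
      rw [hg, norm_smul, mul_pow, hzq2, Real.norm_eq_abs, sq_abs, div_pow, Real.sq_sqrt (by norm_num)]; norm_num
    nlinarith [norm_nonneg g]
  have hgn : ⟪g, n⟫_ℝ = 0 := by rw [hg, real_inner_smul_left, inner_add_left, hzn, hun]; ring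
  obtain ⟨w, hw, hwn, hwg⟩ := exists_inPlane_slot_ge F hn hmenu hg1 hgn
  have hw1 : ‖F w‖ = 1 := by rw [LinearIsometryEquiv.norm_map, norm_eq_one_of_mem_fccSlots hw]
  have hsum : Real.sqrt 3 / Real.sqrt 2 ≤ ⟪F w, z⟫_ℝ + ⟪F w, u⟫_ℝ := by
    rw [hg, real_inner_smul_right, inner_add_right] at hwg
    have hs2 : 0 < Real.sqrt 2 := Real.sqrt_pos.2 (by norm_num)
    rw [div_le_iff₀ hs2]
    nlinarith
  have hz1 : ⟪F w, z⟫_ℝ ≤ 1 := by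
    have := abs_real_inner_le_norm (F w) z; rw [hw1, hz, one_mul] at this; exact (abs_le.1 this).2
  have hu1 : ⟪F w, u⟫_ℝ ≤ 1 := by
    have := abs_real_inner_le_norm (F w) u; rw [hw1, hu, one_mul] at this; exact (abs_le.1 this).2
  -- `√3/√2 ≥ 6/5`
  have h65 : (6 / 5 : ℝ) ≤ Real.sqrt 3 / Real.sqrt 2 := by
    rw [le_div_iff₀ (Real.sqrt_pos.2 (by norm_num))]
    have h3 : Real.sqrt 3 * Real.sqrt 3 = 3 := Real.mul_self_sqrt (by norm_num)
    have hs2 : 0 ≤ Real.sqrt 2 := Real.sqrt_nonneg 2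
    have hs3 : 0 ≤ Real.sqrt 3 := Real.sqrt_nonneg 3
    nlinarith [h22, h3]
  exact ⟨w, hw, hwn, by linarith, by linarith⟩

end Summit.Ventures.Crystal3D.Theorems

end
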